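import Summits.QuantumFields.YangMills.Theorems.UnitScaleTiltProp7QSymEqTrueLinIter
import Summits.QuantumFields.YangMills.Theorems.UnitScaleTiltProp7SymFrameLinearResponseOfRegPrT3
import HarnessLib

/-!
# Route `UnitScaleTilt`, crux K1 «MinimiserStabilityRegPr» (stmt-QuantumFields-19200), route-R E′ (A′) P-A2 (β), row «(n3)₂-sym» (= H2-1ˢ, px21 g7's N-line), brick N6-id —
# THE LINEAR PART OF THE «(n3)₂-sym» SUMMAND AT EVERY LEVEL IS THE TRUE-LINEARISATION ITERATE:
# `D[t ↦ Ū⁽ˡ⁾(e^{t}·W♭)(b)](0)(A) · (Ūˡ[W](b))⋆ = Q^{(l)}_W A (b)`, `0 ≤ l ≤ K − n`, `A` 𝔰𝔲(2)-valued, `W` printed-regular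

Cell `ym3-torus` (HUMAN RULING D-0037, YM ladder rung R3), D-0154 (3c) twin-width seat `ym-routeR-w3` (gen 8; route-R v2 second registered line).  THEOREMS ONLY (0 `def`, 0 `sorry`);
`--supports stmt-QuantumFields-19200 --as helper`, count-neutral.  YM₃ on T³ is a ladder rung (R3) — NOT d = 4, NOT infinite volume, NOT a mass gap, NOT the Clay problem; nothing here
claims `hN2s`, (β), E′, the stub `stub_existenceMinimalOrbit`, the crux or the gap.

WHY.  The displayed OPEN row `hN2s` of ✓ `Prop7SymFrameRem2RowOfN32SymT3.hRs_of_hN2s` (px16 g5; the «(n3)₂-sym» row, px13 g6 F-γ3a summed) bounds, at every level `l < K − n`,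
`Σ_b ‖pertVar (Ūˡ W) (Ūˡ W′) b − fderiv ℂ (t ↦ ↑(emlIterU l (fun b′ ↦ expUnit (t b′) * bgUnits F K W b′) b)) 0 (I•X) * star ↑(Ūˡ W b)‖` (`Ū = Averaging.iter blockAvg expMeanLogSU`,
`W′ = e^{iX}W`).  The sparse two-channel `ℓ¹` engine of the N-line (px21 g7 ✓∕⧗ `Prop7TrueLinSourcedSparseL1.sum_norm_sourced_le_sparse`, on ✓ A1
`Prop7TrueLinSourcedStructure`) eats the SOURCED family `D′_l := Y_l − Q^{(l)}(iX)` (`D′_{l+1} = T_lD′_l + rem_l`), `Q` the ALGEBRAIC true-linearisation recursion family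
(`hQ0 ∕ hQs`, the E′ letters of ✓ `Prop7FibreTrueLinDefect` ∕ ✓ `Prop7QSymEqTrueLinIter`).  The identification of the DISPLAYED linear part with `Q^{(l)}` is in the tree only at
`l = 0` (px13 g6 ✓ `Prop7FrameRem2RowZeroT3.fderiv_emlIterU_zero_mul_star_eq`: it is `iX_b`) and at the top `l = K − n` through the logarithmic chart (★routeR-w2 g7
✓ `Prop7QSymEqTrueLinIter.QSym_apply_eq_trueLinIter`).  This file proves it at EVERY level, so the N6 member knit rewrites `hN2s`'s summand to `‖D′_l b‖` by `rw`.

THE PROOF is ★routeR-w2 g7's one-variable chain rule with the `mlog` step deleted and `K − n ↦ l`: along the `SU(2)` curve `s ↦ e^{sA}·W` (✓ `bgUnits_expCurve`) the chart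
configuration stays plaquette-small near `s = 0` (✓ `plaqSmall_expCurve_eventually`), so the unguarded units tower IS the `SU(2)` average of record at every `l ≤ K − n`
(✓ `Prop8ChartAllL.coe_emlIterU_unitsField_T3_allL`); the `SU(2)` ratio `s ↦ ↑(Ūˡ(e^{sA}W) b)·(↑(Ūˡ W b))ᴴ` has derivative `Q l A b` (✓ `Prop7TrueLinIterHasDeriv.hasDerivAt_iter_ratio`
under ✓ `tower_loop_rows_of_regPr`); the chart function is ℂ-differentiable at `0` (★routeR-w2 ✓ `Prop7SymFrameLinearResponseOfRegPr.differentiableAt_coe_emlIterU_of_regPr`, SAME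
function text), so its derivative along the real line `s ↦ s•A` is `(fderiv ℂ · 0) A`; derivatives are unique.

WHAT IS PROVED (ns `…Theorems.Prop7EmlIterULinearPartEqTrueLinIter`; T³, `SU(2)`; windows `10¹⁰L⁶ε₀ ≤ 1`, `10¹²L³ε₀ ≤ 1` = the cited suppliers' own).
* ★★ `fderiv_emlIterU_expUnit_apply_mul_star_eq_trueLinIter` — the title, for `A` skew-adjoint and traceless bondwise, ANY `Q` with `hQ0 ∕ hQs`.
* ★ `fderiv_emlIterU_expUnit_apply_I_smul_mul_star_eq_trueLinIter` — the same at `A := (b ↦ I • X b)`, `X` Hermitian traceless bondwise (the `hN2s` letter).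
HONEST SCOPE.  First-order calculus at the background over landed suppliers (no estimate, no fibre, no member row); nothing of [Balaban1985Averaging] Prop. 3 is asserted beyond the
cited tree theorems; levels `1 ≤ l` of the «(n3)₂-sym» ESTIMATE remain the N-line's N1–N6.

References: T. Bałaban, CMP 98 (1985) 17–51 [Balaban1985Averaging] ((11) p.19, (19) p.21, Prop. 3 (122)–(127) p.36); CMP 102 (1985) 277–309 [Balaban1985Variational] ((6) p.278,
(15) p.280, (44)–(48) p.285); CMP 109 (1987) 249–301 [Balaban1987RG1] ((0.4), (0.11) p.253).
-/

set_option autoImplicit false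

noncomputable section

open scoped BigOperators Matrix.Norms.L2Operator Topology

namespace Summit.QuantumFields.YangMills.Theorems.Prop7EmlIterULinearPartEqTrueLinIter

open Filter NormedSpace
open Literature.MathematicalPhysics.QuantumFieldTheory.Balaban1983to89
open Literature.MathematicalPhysics.QuantumFieldTheory.Balaban1983to89.T3ContinuumYM3Torus
open T4Continuum BlockAveraging AveragingRT ExpMeanLog BlockAveragingEMLLinearised BlockAveragingEMLLinearisedBackground BlockAveragingEMLProp2
open T3PrintedRegularMinimiser (RegPr)
open T3RegularMinimiser (regThreshold)
open T3SectALandauChart (bgUnits)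
open B10Eq27TorusAxialLog (unitsField toUField)
open B7Prop1Explicit (expUnit val_expUnit)
open Summit.QuantumFields.YangMills.Theorems.Prop8Chart (emlIterU)
open Summit.QuantumFields.YangMills.Theorems.Prop8ChartAllL (coe_emlIterU_unitsField_T3_allL)
open Summit.QuantumFields.YangMills.Theorems.Prop8Criticality (expCurve_mem)
open Summit.QuantumFields.YangMills.Theorems.Prop7QSymEqTrueLinIter (bgUnits_expCurve plaqSmall_expCurve_eventually)
open Summit.QuantumFields.YangMills.Theorems.Prop7SymFrameLinearResponseOfRegPr (differentiableAt_coe_emlIterU_of_regPr)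
open Summit.QuantumFields.YangMills.Theorems.Prop7TrueLinIterHasDeriv (hasDerivAt_iter_ratio)
open Summit.QuantumFields.YangMills.Theorems.Prop7FirstVariationExactPairing (tower_loop_rows_of_regPr)
open Summit.QuantumFields.YangMills.Theorems.Prop7HolRatioPerStep (coe_mul_star_self)

variable (F : T3Family) {n K : ℕ}

/-! ## §1 ★★ The linear part of the units tower at every level is the true-linearisation iterate -/

/-- ★★ **THE LINEAR PART OF THE «(n3)₂-sym» SUMMAND AT EVERY LEVEL IS THE TRUE-LINEARISATION ITERATE.**  `F` a T³ family, `0 < ε₀`, `10¹⁰L⁶ε₀ ≤ 1`, `10¹²L³ε₀ ≤ 1`, `W`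
printed-regular (`RegPr F n K ε₀ W`), `Q` ANY recursion family of the written-out true one-step linearisations along `W`'s tower (`hQ0 ∕ hQs` — ✓ `QSym_apply_eq_trueLinIter`'s
letters VERBATIM), `A` an 𝔰𝔲(2)-valued bond field (skew-adjoint, traceless), `l ≤ K − n`, `b` a level-`l` bond.  Then
`fderiv ℂ (t ↦ ↑(emlIterU l (fun b′ ↦ expUnit (t b′) * bgUnits F K W b′) b)) 0 A * star ↑(Ūˡ W b) = Q l A b`, `Ū = Averaging.iter (blockAvg expMeanLogSU)`.
At `l = 0` this is px13's ✓ `fderiv_emlIterU_zero_mul_star_eq` (`= A b`); at `l = K − n` it is the `exp ∘`-free core of ✓ `QSym_apply_eq_trueLinIter`.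
[cite: Balaban1985Averaging, (11) p.19, Prop. 3 (122)-(127) p.36; Balaban1987RG1, (0.4), (0.11) p.253] -/
theorem fderiv_emlIterU_expUnit_apply_mul_star_eq_trueLinIter {ε₀ : ℝ} (hε₀ : 0 < ε₀) (hε : 10 ^ 10 * (F.L : ℝ) ^ 6 * ε₀ ≤ 1)
    (hε12 : 10 ^ 12 * (F.L : ℝ) ^ 3 * ε₀ ≤ 1)
    (W : GaugeField (F.P K) 0 (Matrix.specialUnitaryGroup (Fin 2) ℂ)) (hreg : RegPr F n K ε₀ W)
    (Q : (k : ℕ) → (PBond (F.P K) 0 → Matrix (Fin 2) (Fin 2) ℂ) → PBond (F.P K) k → Matrix (Fin 2) (Fin 2) ℂ) (hQ0 : ∀ Y, Q 0 Y = Y)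
    (hQs : ∀ (k : ℕ) (Y : PBond (F.P K) 0 → Matrix (Fin 2) (Fin 2) ℂ) (c : PBond (F.P K) (k + 1)), Q (k + 1) Y c
      = fderiv ℂ (eml : (Idx (F.P K) → Matrix (Fin 2) (Fin 2) ℂ) → Matrix (Fin 2) (Fin 2) ℂ)
            (fun i => ((loopHol (Averaging.iter (fun i => blockAvg (P := F.P K) (j := i) (expMeanLogSU (n := Fin 2))) k W) c i :
              Matrix.specialUnitaryGroup (Fin 2) ℂ) : Matrix (Fin 2) (Fin 2) ℂ))
            (fun i => covWalkSum (Averaging.iter (fun i => blockAvg (P := F.P K) (j := i) (expMeanLogSU (n := Fin 2))) k W) (Q k Y)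
                (walk (emb c.src) (loopWord (F.P K).L c.dir (off i.1) i.2.1 i.2.2))
              * ((loopHol (Averaging.iter (fun i => blockAvg (P := F.P K) (j := i) (expMeanLogSU (n := Fin 2))) k W) c i :
                Matrix.specialUnitaryGroup (Fin 2) ℂ) : Matrix (Fin 2) (Fin 2) ℂ))
            * star ((corr (expMeanLogSU (n := Fin 2)) (Averaging.iter (fun i => blockAvg (P := F.P K) (j := i) (expMeanLogSU (n := Fin 2))) k W) c :
                Matrix.specialUnitaryGroup (Fin 2) ℂ) : Matrix (Fin 2) (Fin 2) ℂ)
          + ((corr (expMeanLogSU (n := Fin 2)) (Averaging.iter (fun i => blockAvg (P := F.P K) (j := i) (expMeanLogSU (n := Fin 2))) k W) c :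
                Matrix.specialUnitaryGroup (Fin 2) ℂ) : Matrix (Fin 2) (Fin 2) ℂ)
            * covWalkSum (Averaging.iter (fun i => blockAvg (P := F.P K) (j := i) (expMeanLogSU (n := Fin 2))) k W) (Q k Y)
                (walk (emb c.src) (List.replicate (F.P K).L (c.dir, true)))
            * star ((corr (expMeanLogSU (n := Fin 2)) (Averaging.iter (fun i => blockAvg (P := F.P K) (j := i) (expMeanLogSU (n := Fin 2))) k W) c :
                Matrix.specialUnitaryGroup (Fin 2) ℂ) : Matrix (Fin 2) (Fin 2) ℂ))
    (A : PBond (F.P K) 0 → Matrix (Fin 2) (Fin 2) ℂ) (hA : ∀ b, A b ∈ skewAdjoint (Matrix (Fin 2) (Fin 2) ℂ)) (htr : ∀ b, (A b).trace = 0)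
    {l : ℕ} (hl : l ≤ K - n) (b : PBond (F.P K) l) :
    fderiv ℂ (fun t : PBond (F.P K) 0 → Matrix (Fin 2) (Fin 2) ℂ =>
        ((emlIterU l (fun b' => expUnit (t b') * bgUnits F K W b') b : (Matrix (Fin 2) (Fin 2) ℂ)ˣ) : Matrix (Fin 2) (Fin 2) ℂ)) 0 A
      * star ((Averaging.iter (fun i => blockAvg (P := F.P K) (j := i) (expMeanLogSU (n := Fin 2))) l W b :
          Matrix.specialUnitaryGroup (Fin 2) ℂ) : Matrix (Fin 2) (Fin 2) ℂ)
      = Q l A b := by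
  classical
  -- windows
  have hL3 : (3 : ℝ) ≤ (F.L : ℝ) := by
    have h3 : 3 ≤ F.L := by obtain ⟨a, ha⟩ := F.hL.1; have := F.hL.2; omega
    exact_mod_cast h3
  have hL1 : (1 : ℝ) ≤ (F.L : ℝ) := by linarith
  have hε7 : 10 ^ 7 * (F.L : ℝ) ^ 3 * ε₀ ≤ 1 := by
    nlinarith [hε12, hε₀.le, pow_nonneg (zero_le_one.trans hL1) 3]
  -- the `SU(2)` exponential curve and its bond ratios
  set Γ₀ : ℝ → GaugeField (F.P K) 0 (Matrix.specialUnitaryGroup (Fin 2) ℂ) :=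
    fun t b => ⟨exp (t • A b) * (W b : Matrix (Fin 2) (Fin 2) ℂ), expCurve_mem (hA b) (htr b) (W b) t⟩ with hΓ₀
  have hΓ₀0 : Γ₀ 0 = W := by
    funext b; apply Subtype.ext
    show exp ((0 : ℝ) • A b) * (W b : Matrix (Fin 2) (Fin 2) ℂ) = (W b : Matrix (Fin 2) (Fin 2) ℂ)
    rw [zero_smul, exp_zero, one_mul]
  have hUU : ∀ b : PBond (F.P K) 0, (W b : Matrix (Fin 2) (Fin 2) ℂ) * star (W b : Matrix (Fin 2) (Fin 2) ℂ) = 1 := fun b => coe_mul_star_self _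
  have hratio : ∀ b : PBond (F.P K) 0, HasDerivAt (fun s : ℝ => ((Γ₀ s b : Matrix.specialUnitaryGroup (Fin 2) ℂ) : Matrix (Fin 2) (Fin 2) ℂ) *
      star ((W b : Matrix.specialUnitaryGroup (Fin 2) ℂ) : Matrix (Fin 2) (Fin 2) ℂ)) (A b) 0 := by
    intro b
    have h1 := (hasDerivAt_exp_smul_const' (A b) (0 : ℝ)).mul_const (W b : Matrix (Fin 2) (Fin 2) ℂ)
    simp only [zero_smul, exp_zero, mul_one] at h1
    have h2 := h1.mul_const (star ((W b : Matrix.specialUnitaryGroup (Fin 2) ℂ) : Matrix (Fin 2) (Fin 2) ℂ))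
    rwa [Matrix.mul_assoc, hUU, Matrix.mul_one] at h2
  -- the E′ side: the ratio of the level-`l` averages has derivative `Q l A b`
  obtain ⟨hα, ha24, haN⟩ := tower_loop_rows_of_regPr F hε₀ hε hreg (K := K) (n := n)
  have hQ := hasDerivAt_iter_ratio W Γ₀ hΓ₀0 A hratio Q hQ0 hQs _ l
    (fun j hj => hα j (lt_of_lt_of_le hj hl)) (fun j hj => ha24 j (lt_of_lt_of_le hj hl)) (fun j hj => haN j (lt_of_lt_of_le hj hl)) b
  -- the chart side: the chain rule through `fderiv ℂ G 0` along the real line `s ↦ s•A`, times the constant `(Ūˡ W b)⋆`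
  have hG := differentiableAt_coe_emlIterU_of_regPr hε₀ hε12 W hreg hl b
  have hGd : HasFDerivAt (fun t : PBond (F.P K) 0 → Matrix (Fin 2) (Fin 2) ℂ =>
        ((emlIterU l (fun b' => expUnit (t b') * bgUnits F K W b') b : (Matrix (Fin 2) (Fin 2) ℂ)ˣ) : Matrix (Fin 2) (Fin 2) ℂ))
      (fderiv ℂ (fun t : PBond (F.P K) 0 → Matrix (Fin 2) (Fin 2) ℂ =>
        ((emlIterU l (fun b' => expUnit (t b') * bgUnits F K W b') b : (Matrix (Fin 2) (Fin 2) ℂ)ˣ) : Matrix (Fin 2) (Fin 2) ℂ)) 0) ((0 : ℝ) • A) := by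
    rw [zero_smul]; exact hG.hasFDerivAt
  have hchain := ((hGd.restrictScalars ℝ).comp_hasDerivAt (0 : ℝ) ((hasDerivAt_id (0 : ℝ)).smul_const A)).mul_const
    (star ((Averaging.iter (fun i => blockAvg (P := F.P K) (j := i) (expMeanLogSU (n := Fin 2))) l W b :
          Matrix.specialUnitaryGroup (Fin 2) ℂ) : Matrix (Fin 2) (Fin 2) ℂ))
  simp only [Function.comp_def, id_eq, one_smul, ContinuousLinearMap.coe_restrictScalars'] at hchain
  -- the two real functions agree near `s = 0`
  have hev : (fun s : ℝ => ((emlIterU l (fun b' => expUnit ((s • A) b') * bgUnits F K W b') b : (Matrix (Fin 2) (Fin 2) ℂ)ˣ) : Matrix (Fin 2) (Fin 2) ℂ)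
        * star ((Averaging.iter (fun i => blockAvg (P := F.P K) (j := i) (expMeanLogSU (n := Fin 2))) l W b :
          Matrix.specialUnitaryGroup (Fin 2) ℂ) : Matrix (Fin 2) (Fin 2) ℂ))
      =ᶠ[𝓝 0] fun s : ℝ =>
        ((Averaging.iter (fun i => blockAvg (P := F.P K) (j := i) (expMeanLogSU (n := Fin 2))) l (Γ₀ s) b :
          Matrix.specialUnitaryGroup (Fin 2) ℂ) : Matrix (Fin 2) (Fin 2) ℂ)
        * star ((Averaging.iter (fun i => blockAvg (P := F.P K) (j := i) (expMeanLogSU (n := Fin 2))) l W b :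
          Matrix.specialUnitaryGroup (Fin 2) ℂ) : Matrix (Fin 2) (Fin 2) ℂ) := by
    filter_upwards [plaqSmall_expCurve_eventually F (n := n) (K := K) hreg A hA htr] with s hs
    rw [bgUnits_expCurve F W A hA htr s]
    exact congrArg (· * _) (coe_emlIterU_unitsField_T3_allL F n K hε₀ hε7 _ hs l hl b)
  -- uniqueness of derivatives
  exact hchain.unique (hQ.congr_of_eventuallyEq hev)

/-! ## §2 ★ The `hN2s` letter: direction `iX`, `X` Hermitian traceless -/

/-- ★ **THE `hN2s` LETTER.**  Under the hypotheses of `fderiv_emlIterU_expUnit_apply_mul_star_eq_trueLinIter`, for a bondwise Hermitian traceless `X` and every level `l ≤ K − n`: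
`fderiv ℂ (t ↦ ↑(emlIterU l (fun b′ ↦ expUnit (t b′) * bgUnits F K W b′) b)) 0 (fun b′ ↦ I • X b′) * star ↑(Ūˡ W b) = Q l (fun b′ ↦ I • X b′) b` — so the summand of px16 G3-s's
`hN2s` at level `l` is `‖pertVar (Ūˡ W) (Ūˡ (e^{iX}W)) b − Q l (iX) b‖`, the `ℓ¹` size of the sourced family `D′_l = Y_l − Q^{(l)}(iX)` of the N-line's engine.
[cite: Balaban1985Averaging, Prop. 3 (122)-(127) p.36; Balaban1985Variational, (15) p.280, (44) p.285] -/
theorem fderiv_emlIterU_expUnit_apply_I_smul_mul_star_eq_trueLinIter {ε₀ : ℝ} (hε₀ : 0 < ε₀) (hε : 10 ^ 10 * (F.L : ℝ) ^ 6 * ε₀ ≤ 1)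
    (hε12 : 10 ^ 12 * (F.L : ℝ) ^ 3 * ε₀ ≤ 1)
    (W : GaugeField (F.P K) 0 (Matrix.specialUnitaryGroup (Fin 2) ℂ)) (hreg : RegPr F n K ε₀ W)
    (Q : (k : ℕ) → (PBond (F.P K) 0 → Matrix (Fin 2) (Fin 2) ℂ) → PBond (F.P K) k → Matrix (Fin 2) (Fin 2) ℂ) (hQ0 : ∀ Y, Q 0 Y = Y)
    (hQs : ∀ (k : ℕ) (Y : PBond (F.P K) 0 → Matrix (Fin 2) (Fin 2) ℂ) (c : PBond (F.P K) (k + 1)), Q (k + 1) Y c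
      = fderiv ℂ (eml : (Idx (F.P K) → Matrix (Fin 2) (Fin 2) ℂ) → Matrix (Fin 2) (Fin 2) ℂ)
            (fun i => ((loopHol (Averaging.iter (fun i => blockAvg (P := F.P K) (j := i) (expMeanLogSU (n := Fin 2))) k W) c i :
              Matrix.specialUnitaryGroup (Fin 2) ℂ) : Matrix (Fin 2) (Fin 2) ℂ))
            (fun i => covWalkSum (Averaging.iter (fun i => blockAvg (P := F.P K) (j := i) (expMeanLogSU (n := Fin 2))) k W) (Q k Y)
                (walk (emb c.src) (loopWord (F.P K).L c.dir (off i.1) i.2.1 i.2.2))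
              * ((loopHol (Averaging.iter (fun i => blockAvg (P := F.P K) (j := i) (expMeanLogSU (n := Fin 2))) k W) c i :
                Matrix.specialUnitaryGroup (Fin 2) ℂ) : Matrix (Fin 2) (Fin 2) ℂ))
            * star ((corr (expMeanLogSU (n := Fin 2)) (Averaging.iter (fun i => blockAvg (P := F.P K) (j := i) (expMeanLogSU (n := Fin 2))) k W) c :
                Matrix.specialUnitaryGroup (Fin 2) ℂ) : Matrix (Fin 2) (Fin 2) ℂ)
          + ((corr (expMeanLogSU (n := Fin 2)) (Averaging.iter (fun i => blockAvg (P := F.P K) (j := i) (expMeanLogSU (n := Fin 2))) k W) c :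
                Matrix.specialUnitaryGroup (Fin 2) ℂ) : Matrix (Fin 2) (Fin 2) ℂ)
            * covWalkSum (Averaging.iter (fun i => blockAvg (P := F.P K) (j := i) (expMeanLogSU (n := Fin 2))) k W) (Q k Y)
                (walk (emb c.src) (List.replicate (F.P K).L (c.dir, true)))
            * star ((corr (expMeanLogSU (n := Fin 2)) (Averaging.iter (fun i => blockAvg (P := F.P K) (j := i) (expMeanLogSU (n := Fin 2))) k W) c :
                Matrix.specialUnitaryGroup (Fin 2) ℂ) : Matrix (Fin 2) (Fin 2) ℂ))
    (X : PBond (F.P K) 0 → Matrix (Fin 2) (Fin 2) ℂ) (hX : ∀ b, (X b).IsHermitian) (hXtr : ∀ b, (X b).trace = 0)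
    {l : ℕ} (hl : l ≤ K - n) (b : PBond (F.P K) l) :
    fderiv ℂ (fun t : PBond (F.P K) 0 → Matrix (Fin 2) (Fin 2) ℂ =>
        ((emlIterU l (fun b' => expUnit (t b') * bgUnits F K W b') b : (Matrix (Fin 2) (Fin 2) ℂ)ˣ) : Matrix (Fin 2) (Fin 2) ℂ)) 0 (fun b' => Complex.I • X b')
      * star ((Averaging.iter (fun i => blockAvg (P := F.P K) (j := i) (expMeanLogSU (n := Fin 2))) l W b :
          Matrix.specialUnitaryGroup (Fin 2) ℂ) : Matrix (Fin 2) (Fin 2) ℂ)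
      = Q l (fun b' => Complex.I • X b') b :=
  fderiv_emlIterU_expUnit_apply_mul_star_eq_trueLinIter F hε₀ hε hε12 W hreg Q hQ0 hQs (fun b' => Complex.I • X b')
    (fun b' => skewAdjoint.mem_iff.2 (by rw [star_smul, Complex.star_def, Complex.conj_I, (hX b').star_eq, neg_smul]))
    (fun b' => by rw [Matrix.trace_smul, hXtr b', smul_zero]) hl b

end Summit.QuantumFields.YangMills.Theorems.Prop7EmlIterULinearPartEqTrueLinIter

end
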